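import Summits.BirchSwinnertonDyer.Rank1Residual.X11b.TorsionLevelCohomology
import Literature.NumberTheory.EllipticCurves.WeilPairingTateDual
import Literature.NumberTheory.EllipticCurves.KummerSequenceConnecting
import Literature.NumberTheory.GaloisRepresentations.LocalDualityDescent
import Literature.NumberTheory.GaloisRepresentations.LocalDualityTheorem
import Literature.NumberTheory.GaloisRepresentations.ContinuousCohomologyVanishing
import Literature.NumberTheory.GaloisRepresentations.BlochKatoSelmerGroup
import HarnessLib

/-!
# X11b, route R1 — the WEIL TRANSPORT `E[n]^D = Hom(E[n], μₙ) ≅ E[n]` on `H¹`, globally and at the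
# completions, and the local Tate pairing of `E[n]` as a Weil cup product

HONEST FRAMING (cell `b2b-bsdres`, run/shared/lean/b2b/bsd-rank1-residual/, verbatim in every
file): the goal of the cell is to DELETE the COMBINATION-SHAPED residual classes of the
Birch–Swinnerton-Dyer formula for ALL analytic-rank `≤ 1` elliptic curves over `ℚ` — "full BSD
formula for every rank `≤ 1` curve in class `C`" assembled STRICTLY from published theorems — so
that the rank-`≤ 1` remainder becomes exactly the CONSTRUCTION-SHAPED classes, which are TYPED
(missing-input `Prop`s), NOT attempted. This is not "finishing BSD". Sub-cell
`b2b-bsdres-multr1-p1` (X11b, route R1 = Castella 2018 Thm. A re-proved along the author's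
erratum); a RESEARCH ROUTE; no claim beyond the stated class; X11b stays CONSTRUCTION-SHAPED;
nothing here changes a label; no named fact is minted (one definition with a body — the inverse
Weil dual map as an intertwining map — and theorems; no `sorry`).

## What is here (Milne ADT I §6, proof of Prop. 6.9: "the cup product induced by the `e_m`-pairing")

The Poitou–Tate fact of the tree (`poitouTate_selmerStructure_duality`) pairs `H¹(K, M)` with
`H¹(K, M^D)`, `M^D = Hom(M, μₙ)` the Tate dual, and states its obstruction in terms of classes
`y ∈ H¹_{𝓕^*}(K, M^D)`.  For `M = E[n]` the Weil pairing identifies `M^D` with `M`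
(`weilDualIntertwining`, tree); this file makes the identification usable on `H¹`:

* `LocBridge.weilDualHom_bijective` (injective by non-degeneracy, `#Hom(E[n], μₙ) = #E[n]`),
  the inverse intertwining map `LocBridge.weilDualInv : E[n]^D →ⁱL E[n]` and the identities
  `w ∘ w⁻¹ = id`, `w⁻¹ ∘ w = id` on points and on `H¹` — over `K`
  (`map_weilDual_map_weilDualInv`, …) and over every extension field (`…_restrictField`), by the
  generic `Levels.map_map_eq_self_of_comp_eq`;
* **the local Tate pairing of `E[n]` is a Weil cup product**: at a place `v`,
  `⟨a, H¹(w_v) b⟩_v = inv_v (a ∪_{e,v} b)` (`localTatePairingZMod_map_weilDual`, from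
  `cupProduct_tateDualPairingLocal_map_weilDual`, adjoint naturality of the cup product — the local
  analogue of the tree's `cupProduct_weilContPairing_eq`); and `weilContPairingLocal` IS the
  restriction of `weilContPairing` to `Γ_{K_v}` (`weilContPairingLocal_cupProduct_eq_restrict`, `rfl`);
* intertwining maps preserve unramified classes over a local field (`Levels.map_mem_unramifiedSubgroup`).

References: [MilneADT2006] I §2 (`M^D`), §6 proof of Prop. 6.9; [SilvermanAEC2009] III.8.1;
[JetchevSkinnerWan2017] Prop. 3.3.2 (where the transport is used implicitly: "`T^* = T`").
-/

noncomputable section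

open scoped Classical

open CategoryTheory Field NumberField IsDedekindDomain
open Literature.NumberTheory.EllipticCurves
open Literature.NumberTheory.GaloisRepresentations
open Literature.NumberTheory.GaloisRepresentations.DiscreteGaloisModule (mu MuCarrier pairing TateDual
  tateDual tateDualPairing tateDualPairingLocal localTatePairing localTatePairingZMod unramifiedSubgroup)
open Literature.NumberTheory.GaloisCohomology
open scoped ContRepresentation

universe u

-- Cup products need `LocallyCompactSpace Γ`: compactness of `Γ_F` as a local instance only.
attribute [local instance] absoluteGaloisGroup_compactSpace

/-! ## §1. Generic: `H¹(g) ∘ H¹(f) = id` when `g ∘ f = id`; intertwining maps preserve `H¹_ur` -/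

namespace Summit.BirchSwinnertonDyer.Rank1Residual.X11b.Levels

section Generic

variable {F : Type u} [Field F] {M₁ M₂ : Type u}
  [AddCommGroup M₁] [TopologicalSpace M₁] [DiscreteTopology M₁]
  [AddCommGroup M₂] [TopologicalSpace M₂] [DiscreteTopology M₂]
  {ρ₁ : DiscreteGaloisModule F M₁} {ρ₂ : DiscreteGaloisModule F M₂}

/-- **`H¹(g) (H¹(f) x) = x` when `g ∘ f = id` pointwise.** Serre, *Galois Cohomology*, I.§2.2.
[folklore] -/
theorem map_map_eq_self_of_comp_eq (f : ρ₁.toContRepresentation →ⁱL ρ₂.toContRepresentation)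
    (g : ρ₂.toContRepresentation →ⁱL ρ₁.toContRepresentation) (hcomp : ∀ a : M₁, g (f a) = a)
    (x : galoisCohomology ρ₁ 1) :
    galoisCohomology.map g 1 (galoisCohomology.map f 1 x) = x := by
  obtain ⟨φ, rfl⟩ := oneCocycleClass_surjective _ x
  rw [galoisCohomology.map_one_oneCocycleClass, galoisCohomology.map_one_oneCocycleClass]
  exact congrArg (oneCocycleClass _) (Subtype.ext (ContinuousMap.ext fun σ ↦ hcomp (φ.1 σ)))

/-- Hence `H¹(f)` is injective and `H¹(g)` is surjective when `g ∘ f = id`. [folklore] -/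
theorem map_injective_of_comp_eq (f : ρ₁.toContRepresentation →ⁱL ρ₂.toContRepresentation)
    (g : ρ₂.toContRepresentation →ⁱL ρ₁.toContRepresentation) (hcomp : ∀ a : M₁, g (f a) = a) :
    Function.Injective (galoisCohomology.map f 1) :=
  Function.LeftInverse.injective (g := galoisCohomology.map g 1) (map_map_eq_self_of_comp_eq f g hcomp)

end Generic

section Unramified

variable {F : Type u} [Field F] [ValuativeRel F]
  {M₁ M₂ : Type u} [AddCommGroup M₁] [TopologicalSpace M₁] [DiscreteTopology M₁]
  [AddCommGroup M₂] [TopologicalSpace M₂] [DiscreteTopology M₂]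
  {ρ₁ : DiscreteGaloisModule F M₁} {ρ₂ : DiscreteGaloisModule F M₂}

/-- **Intertwining maps preserve unramified classes**: `H¹(f)` maps `H¹_ur(F, M₁)` into
`H¹_ur(F, M₂)` over a non-archimedean local field `F` (restriction to `F^{nr}` commutes with the
change of coefficients, `galoisCohomology.res_map_one`). [cite: MilneADT2006, Ch. I §2, before Thm. 2.6] -/
theorem map_mem_unramifiedSubgroup (f : ρ₁.toContRepresentation →ⁱL ρ₂.toContRepresentation)
    {c : galoisCohomology ρ₁ 1} (hc : c ∈ unramifiedSubgroup ρ₁ 1) :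
    galoisCohomology.map f 1 c ∈ unramifiedSubgroup ρ₂ 1 := by
  rw [DiscreteGaloisModule.mem_unramifiedSubgroup_iff] at hc ⊢
  rw [galoisCohomology.res_map_one, hc, map_zero]

end Unramified

end Summit.BirchSwinnertonDyer.Rank1Residual.X11b.Levels

/-! ## §2. The Weil dual map is bijective; its inverse as an intertwining map; effect on `H¹` -/

namespace Summit.BirchSwinnertonDyer.Rank1Residual.X11b.LocBridge

open Summit.BirchSwinnertonDyer.Rank1Residual.X11b.Levels

section Global

variable {F : Type u} [Field F] [CharZero F] (W : WeierstrassCurve F) (n : ℕ) [NeZero n]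
  [W.IsElliptic]
variable (e : W.geomTorsion n → W.geomTorsion n → AlgebraicClosure F)
  (hμ : ∀ S T, e S T ^ n = 1)
  (hadd₁ : ∀ S₁ S₂ T, e (S₁ + S₂) T = e S₁ T * e S₂ T)
  (hadd₂ : ∀ S T₁ T₂, e S (T₁ + T₂) = e S T₁ * e S T₂)
  (hgal : ∀ (σ : absoluteGaloisGroup F) (S T : W.geomTorsion n), σ • e S T = e (σ • S) (σ • T))
  (hnondeg : ∀ T, (∀ S, e S T = 1) → T = 0)

attribute [local instance] finite_geomTorsion_of_neZero

/-- `Hom(E[n], μₙ(F̄))` (the Tate dual `TateDual F E[n] n`) is finite (it is the tree's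
`HomCarrier E[n] μₙ`, finite for finite `E[n]`, `μₙ`). [folklore] -/
theorem finite_tateDual_geomTorsion : Finite (TateDual F (W.geomTorsion n) n) :=
  haveI : Finite (MuCarrier F n) := Literature.NumberTheory.GaloisRepresentations.finite_muCarrier F n
  inferInstanceAs (Finite (HomCarrier (W.geomTorsion n) (MuCarrier F n)))

attribute [local instance] finite_tateDual_geomTorsion

include hnondeg in
/-- **The Weil dual map `E[n] → E[n]^D` is bijective** for a non-degenerate `e`: injective
(`weilDualHom_injective`) and `#Hom(E[n], μₙ) = #E[n]` (`HomCarrier.natCard_eq`, `μₙ(F̄) ≃ ℤ/n`).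
Silverman, *AEC*, III.8.1; Milne, *ADT*, I §0 (`M^DD = M`). [cite: SilvermanAEC2009, Prop. III.8.1] -/
theorem weilDualHom_bijective : Function.Bijective (weilDualHom W n e hμ hadd₁ hadd₂) :=
  (weilDualHom_injective W n e hμ hadd₁ hadd₂ hnondeg).bijective_of_nat_card_le
    (le_of_eq (HomCarrier.natCard_eq (muEquivZMod F n)
      (fun T : W.geomTorsion n ↦ AddSubgroup.torsionBy.nsmul T)))

/-- **The inverse Weil dual map `w⁻¹ : E[n]^D → E[n]` as a continuous `Γ_F`-intertwining map** of the
discrete Galois modules (inverse of the bijective equivariant `weilDualIntertwining`). [folklore] -/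
def weilDualInv : ((W.torsionGaloisModule n).tateDual n).toContRepresentation →ⁱL
    (W.torsionGaloisModule n).toContRepresentation where
  toContinuousLinearMap :=
    ⟨((AddEquiv.ofBijective (weilDualHom W n e hμ hadd₁ hadd₂)
        (weilDualHom_bijective W n e hμ hadd₁ hadd₂ hnondeg)).symm.toAddMonoidHom).toIntLinearMap,
      continuous_of_discreteTopology⟩
  isIntertwining' σ := by
    refine ContinuousLinearMap.ext fun f ↦ ?_
    change (AddEquiv.ofBijective _ (weilDualHom_bijective W n e hμ hadd₁ hadd₂ hnondeg)).symm
        (((W.torsionGaloisModule n).tateDual n).toContRepresentation σ f) =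
      (W.torsionGaloisModule n).toContRepresentation σ
        ((AddEquiv.ofBijective _ (weilDualHom_bijective W n e hμ hadd₁ hadd₂ hnondeg)).symm f)
    apply (AddEquiv.ofBijective _ (weilDualHom_bijective W n e hμ hadd₁ hadd₂ hnondeg)).injective
    rw [AddEquiv.apply_symm_apply, ContinuousRep.toContRepresentation_apply_apply,
      ContinuousRep.toContRepresentation_apply_apply, WeierstrassCurve.torsionGaloisModule_apply_apply,
      AddEquiv.ofBijective_apply, weilDualHom_smul W n e hμ hadd₁ hadd₂ hgal]
    exact congrArg ((W.torsionGaloisModule n).tateDual n σ)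
      ((AddEquiv.ofBijective _ (weilDualHom_bijective W n e hμ hadd₁ hadd₂ hnondeg)).apply_symm_apply
        f).symm

/-- `w (w⁻¹ f) = f`. [folklore] -/
@[simp]
theorem weilDualIntertwining_weilDualInv (f : TateDual F (W.geomTorsion n) n) :
    weilDualIntertwining W n e hμ hadd₁ hadd₂ hgal (weilDualInv W n e hμ hadd₁ hadd₂ hgal hnondeg f) = f :=
  (AddEquiv.ofBijective (weilDualHom W n e hμ hadd₁ hadd₂)
    (weilDualHom_bijective W n e hμ hadd₁ hadd₂ hnondeg)).apply_symm_apply f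

/-- `w⁻¹ (w T) = T`. [folklore] -/
@[simp]
theorem weilDualInv_weilDualIntertwining (T : W.geomTorsion n) :
    weilDualInv W n e hμ hadd₁ hadd₂ hgal hnondeg (weilDualIntertwining W n e hμ hadd₁ hadd₂ hgal T) = T :=
  (AddEquiv.ofBijective (weilDualHom W n e hμ hadd₁ hadd₂)
    (weilDualHom_bijective W n e hμ hadd₁ hadd₂ hnondeg)).symm_apply_apply T

/-- **On `H¹(F, ·)`: `H¹(w) (H¹(w⁻¹) y) = y`** — every class of `H¹(F, E[n]^D)` is the Weil transport
of a class of `H¹(F, E[n])`. [cite: MilneADT2006, Ch. I §6, proof of Prop. 6.9] -/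
theorem map_weilDual_map_weilDualInv (y : galoisCohomology ((W.torsionGaloisModule n).tateDual n) 1) :
    galoisCohomology.map (weilDualIntertwining W n e hμ hadd₁ hadd₂ hgal) 1
        (galoisCohomology.map (weilDualInv W n e hμ hadd₁ hadd₂ hgal hnondeg) 1 y) = y :=
  map_map_eq_self_of_comp_eq _ _ (weilDualIntertwining_weilDualInv W n e hμ hadd₁ hadd₂ hgal hnondeg) y

/-- **On `H¹(F, ·)`: `H¹(w⁻¹) (H¹(w) x) = x`.** [folklore] -/
theorem map_weilDualInv_map_weilDual (x : galoisCohomology (W.torsionGaloisModule n) 1) :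
    galoisCohomology.map (weilDualInv W n e hμ hadd₁ hadd₂ hgal hnondeg) 1
        (galoisCohomology.map (weilDualIntertwining W n e hμ hadd₁ hadd₂ hgal) 1 x) = x :=
  map_map_eq_self_of_comp_eq _ _ (weilDualInv_weilDualIntertwining W n e hμ hadd₁ hadd₂ hgal hnondeg) x

variable (E : Type u) [Field E] [Algebra F E]

/-- **Over an extension field `E` (a completion): `H¹(w|_E) (H¹(w⁻¹|_E) y) = y`.** [folklore] -/
theorem map_weilDual_map_weilDualInv_restrictField
    (y : galoisCohomology (GaloisRep.restrictField E ((W.torsionGaloisModule n).tateDual n)) 1) :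
    galoisCohomology.map ((weilDualIntertwining W n e hμ hadd₁ hadd₂ hgal).restrictField E) 1
        (galoisCohomology.map ((weilDualInv W n e hμ hadd₁ hadd₂ hgal hnondeg).restrictField E) 1 y) =
      y :=
  map_map_eq_self_of_comp_eq
    (ρ₁ := GaloisRep.restrictField E ((W.torsionGaloisModule n).tateDual n))
    (ρ₂ := GaloisRep.restrictField E (W.torsionGaloisModule n))
    _ _ (weilDualIntertwining_weilDualInv W n e hμ hadd₁ hadd₂ hgal hnondeg) y

/-- **Over an extension field `E`: `H¹(w⁻¹|_E) (H¹(w|_E) x) = x`**; in particular `H¹(w|_E)` is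
injective. [folklore] -/
theorem map_weilDualInv_map_weilDual_restrictField
    (x : galoisCohomology (GaloisRep.restrictField E (W.torsionGaloisModule n)) 1) :
    galoisCohomology.map ((weilDualInv W n e hμ hadd₁ hadd₂ hgal hnondeg).restrictField E) 1
        (galoisCohomology.map ((weilDualIntertwining W n e hμ hadd₁ hadd₂ hgal).restrictField E) 1 x) =
      x :=
  map_map_eq_self_of_comp_eq
    (ρ₁ := GaloisRep.restrictField E (W.torsionGaloisModule n))
    (ρ₂ := GaloisRep.restrictField E ((W.torsionGaloisModule n).tateDual n))
    _ _ (weilDualInv_weilDualIntertwining W n e hμ hadd₁ hadd₂ hgal hnondeg) x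

include hnondeg in
/-- `H¹(w|_E)` is injective (for `e` non-degenerate). [folklore] -/
theorem map_weilDual_restrictField_injective :
    Function.Injective
      (galoisCohomology.map ((weilDualIntertwining W n e hμ hadd₁ hadd₂ hgal).restrictField E) 1) :=
  map_injective_of_comp_eq
    (ρ₁ := GaloisRep.restrictField E (W.torsionGaloisModule n))
    (ρ₂ := GaloisRep.restrictField E ((W.torsionGaloisModule n).tateDual n))
    _ ((weilDualInv W n e hμ hadd₁ hadd₂ hgal hnondeg).restrictField E)
    (weilDualInv_weilDualIntertwining W n e hμ hadd₁ hadd₂ hgal hnondeg)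

end Global

/-! ## §3. At a place of a number field: the local Tate pairing of `E[n]` is the Weil cup product -/

section Local

variable {K : Type u} [Field K] [NumberField K] (W : WeierstrassCurve K) (n : ℕ) [NeZero n]
  [W.IsElliptic]
variable (e : W.geomTorsion n → W.geomTorsion n → AlgebraicClosure K)
  (hμ : ∀ S T, e S T ^ n = 1)
  (hadd₁ : ∀ S₁ S₂ T, e (S₁ + S₂) T = e S₁ T * e S₂ T)
  (hadd₂ : ∀ S T₁ T₂, e S (T₁ + T₂) = e S T₁ * e S T₂)
  (hgal : ∀ (σ : absoluteGaloisGroup K) (S T : W.geomTorsion n), σ • e S T = e (σ • S) (σ • T))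

attribute [local instance] finite_geomTorsion_of_neZero

omit [W.IsElliptic] in
/-- The local Weil pairing `weilContPairingLocal … v` IS the restriction of `weilContPairing` to
`Γ_{K_v}` (same bilinear map; definitional), stated on cup products. [folklore] -/
theorem weilContPairingLocal_cupProduct_eq_restrict (v : Place K)
    (a b : galoisCohomology ((W.torsionGaloisModule n).toLocal v) 1) :
    (weilContPairingLocal W n e hμ hadd₁ hadd₂ hgal v).cupProduct a b =
      ((weilContPairing W n e hμ hadd₁ hadd₂ hgal).restrict
        (absGaloisRestrict K (Place.Completion v))).cupProduct a b :=
  rfl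

/-- **`a ∪_{ev,v} H¹(w_v)(b) = a ∪_{e,v} b` in `H²(K_v, μₙ)`** for local classes
`a, b ∈ H¹(K_v, E[n])`: the evaluation cup product (that of the local Tate pairing,
`tateDualPairingLocal`) of `a` with the Weil transport of `b` is the local Weil cup product
(adjoint naturality of the cup product, `ContPairing.cupProduct_adjoint`, with `e(S, T) = (w T)(S)`;
the local analogue of the tree's `cupProduct_weilContPairing_eq`). [cite: MilneADT2006, Ch. I §6, proof of Prop. 6.9] -/
theorem cupProduct_tateDualPairingLocal_map_weilDual (v : Place K)
    (a b : galoisCohomology ((W.torsionGaloisModule n).toLocal v) 1) :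
    (tateDualPairingLocal (W.torsionGaloisModule n) n v).cupProduct a
        (galoisCohomology.map ((weilDualIntertwining W n e hμ hadd₁ hadd₂ hgal).restrictField
          (Place.Completion v)) 1 b) =
      (weilContPairingLocal W n e hμ hadd₁ hadd₂ hgal v).cupProduct a b := by
  have h := ContPairing.cupProduct_adjoint (tateDualPairingLocal (W.torsionGaloisModule n) n v)
    (weilContPairingLocal W n e hμ hadd₁ hadd₂ hgal v) (𝟙 _)
    (DiscreteGaloisModule.homOfIntertwining
      ((weilDualIntertwining W n e hμ hadd₁ hadd₂ hgal).restrictField (Place.Completion v)))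
    (fun S T ↦ rfl) a b
  have h1 : (cohomologyMap (𝟙 ((W.torsionGaloisModule n).toLocal v).toTopRep) 1) a = a := by
    rw [show cohomologyMap (𝟙 ((W.torsionGaloisModule n).toLocal v).toTopRep) 1 = 𝟙 _ from
      map_id_eq_id _ (fun _ ↦ rfl) 1]
    rfl
  rw [h1] at h
  exact h.symm

/-- **The local Tate pairing of `E[n]` through the Weil transport is `inv_v` of the local Weil cup
product**: `⟨a, H¹(w_v) b⟩_v = inv_v (a ∪_{e,v} b)` for any additive `inv_v : H²(K_v, μₙ) → ℤ/n`
(`localTatePairingZMod`, the pairing of the tree's Poitou–Tate facts). [cite: MilneADT2006, Ch. I §6, proof of Prop. 6.9] -/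
theorem localTatePairingZMod_map_weilDual (v : Place K)
    (inv : galoisCohomology ((mu K n).toLocal v) 2 →+ ZMod n)
    (a b : galoisCohomology ((W.torsionGaloisModule n).toLocal v) 1) :
    localTatePairingZMod (W.torsionGaloisModule n) n v inv a
        (galoisCohomology.map ((weilDualIntertwining W n e hμ hadd₁ hadd₂ hgal).restrictField
          (Place.Completion v)) 1 b) =
      inv ((weilContPairingLocal W n e hμ hadd₁ hadd₂ hgal v).cupProduct a b) := by
  rw [DiscreteGaloisModule.localTatePairingZMod_apply, ← cupProduct_tateDualPairingLocal_map_weilDual]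
  rfl

end Local

end Summit.BirchSwinnertonDyer.Rank1Residual.X11b.LocBridge

end
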